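/-
Copyright (c) 2026 the pub-hodgecm-mathlib formalisation cell (harness21).  Prover seat hodgecm-mathlib-K2Liu-p09 (g6): Track B «K2-LIT»,
hLiu418 = stmt-HodgeConjecture-24832; LEAD F0P6-plan RULING M-158d «A7-val road (σ)», instance socket `[TotallyDisconnectedSpace (localPi …)]`.
-/
import Literature.NumberTheory.Automorphic.UnitaryGroupLocalFactors      -- ★ `UnitaryGroup.LocalGLPi`, `UnitaryGroup.localPi`
import Literature.NumberTheory.Automorphic.FinAdelicTotallyDisconnected  -- ★ `Valued.totallyDisconnectedSpace'`, `totallyDisconnectedSpace_matrix`, `totallyDisconnectedSpace_units`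
import HarnessLib

/-!
# Crux `HLiu418`, road `K2_Liu`, organ A7-val: `U(J)(F_v) = localPi E c N J v` IS TOTALLY DISCONNECTED

Cell `hodgecm-mathlib`, crux item hLiu418 = `stmt-HodgeConjecture-24832`; squad K2 ∕ K2Liu; prover K2Liu-p09 (g6), organ lead A7-val.  THEOREMS ONLY; lane
`--supports stmt-HodgeConjecture-24832` (count-neutral helper).  Generic `F E c N J v`.
* `totallyDisconnectedSpace_localGLPi`: `Π_{w ∣ v} GL_N(E_w)` is totally disconnected (units of matrices over the valued fields `E_w`);
* **`totallyDisconnectedSpace_localPi`**: so is the subgroup `U(J)(F_v)` — the two `[TotallyDisconnectedSpace …]` sockets (`H_v`, `G = U(V′_v)`) of ★ I-4b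
  `K2LiuA7ValueInstanceFace.faceA4R_two_of_record`.  Theorems, not instances (the assembly uses `haveI`).
HONEST LABEL.  `HC_CM` is proved only modulo the 7 printed citations (2 remaining named inputs: hLiu418 = `stmt-HodgeConjecture-24832`,
h413 = `stmt-HodgeConjecture-24833`) until rung 0 closes.

## References
* [PlatonovRapinchuk1994] V. Platonov, A. Rapinchuk, Algebraic Groups and Number Theory, §3.3 (p-adic Lie groups are totally disconnected).
-/

set_option autoImplicit false
set_option linter.dupNamespace false -- the mandated namespace repeats `HodgeConjecture.HodgeConjecture`

noncomputable section

open NumberField IsDedekindDomain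
open Literature.NumberTheory.Automorphic Literature.NumberTheory.Automorphic.UnitaryGroup

namespace Summit.HodgeConjecture.HodgeConjecture.Cruxes.HLiu418.K2LiuLocalPiTotallyDisconnected

variable (F : Type) [Field F] [NumberField F] (E : Type) [Field E] [NumberField E] [Algebra F E] (c : E ≃ₐ[F] E) (N : ℕ)
  (J : Matrix (Fin N) (Fin N) E) (v : HeightOneSpectrum (𝓞 F))

omit [NumberField F] in
/-- **`Π_{w ∣ v} GL_N(E_w)` is totally disconnected** (each `E_w` is a valued field; matrices; units; finite product). [cite: PlatonovRapinchuk1994, §3.3] -/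
theorem totallyDisconnectedSpace_localGLPi : TotallyDisconnectedSpace (UnitaryGroup.LocalGLPi E N v) := by
  haveI : ∀ w : UnitaryGroup.PlacesOver E v, TotallyDisconnectedSpace (w.1.adicCompletion E) := fun w => Valued.totallyDisconnectedSpace'
  haveI : ∀ w : UnitaryGroup.PlacesOver E v, TotallyDisconnectedSpace (Matrix (Fin N) (Fin N) (w.1.adicCompletion E)) := fun w =>
    totallyDisconnectedSpace_matrix
  haveI : ∀ w : UnitaryGroup.PlacesOver E v, TotallyDisconnectedSpace (GL (Fin N) (w.1.adicCompletion E)) := fun w => totallyDisconnectedSpace_units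
  infer_instance

/-- **`U(J)(F_v) = localPi E c N J v` is totally disconnected** (a subgroup of `Π_{w ∣ v} GL_N(E_w)`) — the `[TotallyDisconnectedSpace H_v]` and
`[TotallyDisconnectedSpace U(V′_v)]` sockets of ★ I-4b `faceA4R_two_of_record`. [cite: PlatonovRapinchuk1994, §3.3; §6.2] -/
theorem totallyDisconnectedSpace_localPi : TotallyDisconnectedSpace (UnitaryGroup.localPi E c N J v) := by
  haveI := totallyDisconnectedSpace_localGLPi F E N v
  exact inferInstanceAs (TotallyDisconnectedSpace ↥(UnitaryGroup.localPi E c N J v))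

end Summit.HodgeConjecture.HodgeConjecture.Cruxes.HLiu418.K2LiuLocalPiTotallyDisconnected

end
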